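import Summits.QuantumFields.YangMills.Theorems.IsotropyFromPowerCountingTemperedCurvatureMomentsThreePointChartBoundsPair

/-!
# Three-point chart bounds V: arbitrary mirror level and either order of the pair (standard frame)

Support file for stub `stub_threePointChartBounds` (B) of reshape 4 of
`Cruxes/TemperedCurvatureMoments/Lines/Sketch.lean` (crux stmt-QuantumFields-17721, line `Sketch`).
Absorption of the distance of the support from the origin into Schwartz weights
(`(1+r)ᵏ |φ|_M ≤ 2ᵏ |φ|_{M+k}` if `supp φ ⊆ {‖y‖ ≥ r}`), three-slot tensor bookkeeping, and
`norm_three_point_standard`: the ordered-pair bound uniformly in the mirror level `c` (translate by `−c e₀`,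
swap the pair by E3 if needed, absorb `(2(1+|c|))^M`).
References: Osterwalder–Schrader, Comm. Math. Phys. 31 (1973) §4.1, 42 (1975) §4; Glimm–Jaffe, Quantum
Physics (1987) Thm. 6.1.3, §19.5. [folklore]
-/

noncomputable section

open scoped InnerProductSpace ComplexConjugate
open MeasureTheory Filter Set Complex
open _root_.Topology
open Literature.MathematicalPhysics.AQFT Literature.MathematicalPhysics.QuantumLattice
open Literature.MathematicalPhysics.QuantumFieldTheory
open scoped SchwartzMap LineDeriv
open Literature.MathematicalPhysics.QuantumLattice.SchwingerFamily (timeVec)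
open Summit.QuantumFields.YangMills.Theorems.CurvatureKernel
open Summit.QuantumFields.YangMills.Cruxes.PlanarSpectralCone.TwoMirrorLightconeSlots.DiscSections (translateMulti_time_space)

namespace Summit.QuantumFields.YangMills.Theorems.TemperedCurvatureMoments.Sketch.ThreePointChartBounds

/-! ## Schwartz weights absorb the distance of the support from the origin -/

section Absorb

variable {X : Type*} [NormedAddCommGroup X] [NormedSpace ℝ X]

/-- **Far supports have large Schwartz norms**: if `supp φ ⊆ {‖y‖ ≥ r}` then
`rᵏ |φ|_M ≤ |φ|_{M+k}`. [folklore] -/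
theorem pow_mul_schwartzNorm_le_of_le_norm (φ : 𝓢(X, ℂ)) {r : ℝ} (hr : 0 ≤ r)
    (hφ : tsupport (φ : X → ℂ) ⊆ {y | r ≤ ‖y‖}) (M k : ℕ) :
    r ^ k * schwartzNorm M φ ≤ schwartzNorm (M + k) φ := by
  rcases hr.eq_or_lt with hr0 | hr0
  · rw [← hr0]
    rcases Nat.eq_zero_or_pos k with hk | hk
    · rw [hk, pow_zero, one_mul]
      exact schwartzNorm_mono (Nat.le_add_right M 0) φ
    · rw [zero_pow hk.ne', zero_mul]
      exact schwartzNorm_nonneg _ _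
  · rw [← le_div_iff₀' (pow_pos hr0 k)]
    refine Seminorm.finset_sup_apply_le (div_nonneg (schwartzNorm_nonneg _ _) (pow_nonneg hr k)) fun i hi => ?_
    obtain ⟨ha, hb⟩ := Prod.mk_le_mk.1 (Finset.mem_Iic.1 hi)
    rw [SchwartzMap.schwartzSeminormFamily_apply, le_div_iff₀' (pow_pos hr0 k)]
    have hle : SchwartzMap.seminorm ℂ (i.1 + k) i.2 φ ≤ schwartzNorm (M + k) φ :=
      seminorm_le_schwartzNorm (by omega) (by omega) φ
    refine le_trans ?_ hle
    rw [mul_comm, ← le_div_iff₀ (pow_pos hr0 k)]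
    refine SchwartzMap.seminorm_le_bound ℂ i.1 i.2 φ (div_nonneg (apply_nonneg _ _) (pow_nonneg hr k))
      fun x => ?_
    rw [le_div_iff₀ (pow_pos hr0 k)]
    by_cases hx : x ∈ tsupport (φ : X → ℂ)
    · have hrx : r ≤ ‖x‖ := hφ hx
      calc ‖x‖ ^ i.1 * ‖iteratedFDeriv ℝ i.2 (φ : X → ℂ) x‖ * r ^ k
          ≤ ‖x‖ ^ i.1 * ‖iteratedFDeriv ℝ i.2 (φ : X → ℂ) x‖ * ‖x‖ ^ k := by
            gcongr
        _ = ‖x‖ ^ (i.1 + k) * ‖iteratedFDeriv ℝ i.2 (φ : X → ℂ) x‖ := by ring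
        _ ≤ SchwartzMap.seminorm ℂ (i.1 + k) i.2 φ := SchwartzMap.le_seminorm ℂ _ _ φ x
    · have h0 : iteratedFDeriv ℝ i.2 (φ : X → ℂ) x = 0 :=
        image_eq_zero_of_notMem_tsupport fun h' => hx (tsupport_iteratedFDeriv_subset i.2 h')
      rw [h0, norm_zero, mul_zero, zero_mul]
      exact apply_nonneg _ _

/-- **Absorption**: if `supp φ ⊆ {‖y‖ ≥ r}` then `(1 + r)ᵏ |φ|_M ≤ 2ᵏ |φ|_{M+k}`. [folklore] -/
theorem one_add_pow_mul_schwartzNorm_le (φ : 𝓢(X, ℂ)) {r : ℝ} (hr : 0 ≤ r)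
    (hφ : tsupport (φ : X → ℂ) ⊆ {y | r ≤ ‖y‖}) (M k : ℕ) :
    (1 + r) ^ k * schwartzNorm M φ ≤ 2 ^ k * schwartzNorm (M + k) φ := by
  have hφ0 := schwartzNorm_nonneg M φ
  have hmono : schwartzNorm M φ ≤ schwartzNorm (M + k) φ := schwartzNorm_mono (Nat.le_add_right M k) φ
  rcases le_or_gt r 1 with hr1 | hr1
  · calc (1 + r) ^ k * schwartzNorm M φ ≤ 2 ^ k * schwartzNorm M φ := by
          gcongr; linarith
      _ ≤ 2 ^ k * schwartzNorm (M + k) φ := by gcongr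
  · have h1 : (1 + r) ^ k ≤ 2 ^ k * r ^ k := by
      rw [← mul_pow]; exact pow_le_pow_left₀ (by positivity) (by linarith) k
    calc (1 + r) ^ k * schwartzNorm M φ ≤ 2 ^ k * r ^ k * schwartzNorm M φ := by gcongr
      _ = 2 ^ k * (r ^ k * schwartzNorm M φ) := by ring
      _ ≤ 2 ^ k * schwartzNorm (M + k) φ := by
          gcongr; exact pow_mul_schwartzNorm_le_of_le_norm φ hr hφ M k

end Absorb

/-! ## Three-slot tensors: translations, permutations, off-diagonality -/

section ThreeSlot

/-- `(a ⊗ b ⊗ c)(x) = a(x₀) b(x₁) c(x₂)`. [folklore] -/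
theorem tensorFin_three_eval (a b c : 𝓢(EuclideanSpace ℝ (Fin 4), ℂ)) (x : Fin 3 → EuclideanSpace ℝ (Fin 4)) :
    SchwartzMap.tensorFin 3 ![a, b, c] x = a (x 0) * b (x 1) * c (x 2) := by
  simp [SchwartzMap.tensorFin_apply, Fin.prod_univ_three]

/-- Diagonal translation of a three-slot tensor. [folklore] -/
theorem translateMulti_tensorFin_three (v : EuclideanSpace ℝ (Fin 4)) (a b c : 𝓢(EuclideanSpace ℝ (Fin 4), ℂ)) :
    translateMulti v (SchwartzMap.tensorFin 3 ![a, b, c]) =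
      SchwartzMap.tensorFin 3 ![SchwartzMap.compSubConstCLM ℂ v a, SchwartzMap.compSubConstCLM ℂ v b,
        SchwartzMap.compSubConstCLM ℂ v c] := by
  ext x
  rw [translateMulti_apply, tensorFin_three_eval, tensorFin_three_eval]
  rfl

/-- Swapping the first two slots of a three-slot tensor. [folklore] -/
theorem permTest_swap_tensorFin_three (a b c : 𝓢(EuclideanSpace ℝ (Fin 4), ℂ)) :
    permTest (Equiv.swap 0 1) (SchwartzMap.tensorFin 3 ![b, a, c]) = SchwartzMap.tensorFin 3 ![a, b, c] := by
  ext x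
  rw [permTest_apply, tensorFin_three_eval, tensorFin_three_eval]
  have h2 : Equiv.swap (0 : Fin 3) 1 2 = 2 := Equiv.swap_apply_of_ne_of_ne (by decide) (by decide)
  simp only [Function.comp_apply, Equiv.swap_apply_left, Equiv.swap_apply_right, h2]
  ring

/-- A three-slot tensor with pairwise disjoint factor supports lies in `⁰𝒮₃`. [folklore] -/
theorem isOffDiagonal_tensorFin_three {a b c : 𝓢(EuclideanSpace ℝ (Fin 4), ℂ)}
    (hab : Disjoint (tsupport (a : EuclideanSpace ℝ (Fin 4) → ℂ)) (tsupport (b : EuclideanSpace ℝ (Fin 4) → ℂ)))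
    (hac : Disjoint (tsupport (a : EuclideanSpace ℝ (Fin 4) → ℂ)) (tsupport (c : EuclideanSpace ℝ (Fin 4) → ℂ)))
    (hbc : Disjoint (tsupport (b : EuclideanSpace ℝ (Fin 4) → ℂ)) (tsupport (c : EuclideanSpace ℝ (Fin 4) → ℂ))) :
    IsOffDiagonal (SchwartzMap.tensorFin 3 ![a, b, c]) := by
  have hv : ∀ i j : Fin 3, i ≠ j → Disjoint (tsupport ((![a, b, c] i : 𝓢(EuclideanSpace ℝ (Fin 4), ℂ)) :
      EuclideanSpace ℝ (Fin 4) → ℂ)) (tsupport ((![a, b, c] j : 𝓢(EuclideanSpace ℝ (Fin 4), ℂ)) :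
      EuclideanSpace ℝ (Fin 4) → ℂ)) := by
    intro i j hij
    fin_cases i <;> fin_cases j
    · exact absurd rfl hij
    · simpa using hab
    · simpa using hac
    · simpa using hab.symm
    · exact absurd rfl hij
    · simpa using hbc
    · simpa using hac.symm
    · simpa using hbc.symm
    · exact absurd rfl hij
  refine IsOffDiagonal.of_tsupport_subset fun x hx hxc => ?_
  obtain ⟨i, j, hij, hxij⟩ := hxc
  have hm := apply_mem_tsupport_of_mem_tsupport_tensorFin _ hx
  exact Set.disjoint_left.1 (hv i j hij) (hm i) (by rw [hxij]; exact hm j)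

end ThreeSlot

/-! ## The standard frame: arbitrary mirror level, either order of the pair -/

section Standard

variable (S : SchwingerFamily (EuclideanSpace ℝ (Fin 4))) (h : OSReconstructionNoE1 S.toLabelled)

/-- **The three-point bound in the standard frame**, uniformly in the mirror level `c`: for `𝔖` with E2,
translations and E3 on `⁰𝒮`, joint spectral measures on the planar cone, temperedness bounds for
`𝔖₂`, `𝔖₄` of orders `≤ M`: if `supp f₁, supp f₂ ⊆ {y₀ < c}`, the pair is separated by a time level
`c'`, `supp g ⊆ {y₀ > c + δ}` (`0 < δ ≤ 1`) and `w ∈ {e₀, e₁}`, then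
`|𝔖₃(f₁ ⊗ f₂ ⊗ ∂_wᴺ g)| ≤ (2N/(e δ/2))ᴺ A B 2^{6M} |f₁|_{4M} |f₂|_{4M} |g|_{4M}` (translate the mirror to
`{y₀ = δ/2}`… i.e. by `−c e₀`, swap the pair by E3 if needed, apply the core bound, and absorb the
factors `(2(1+|c|))^M` of the translated Schwartz norms into the weights: the support of `g`
(`c ≥ 0`) or of `f₁, f₂` (`c < 0`) is at distance `≥ |c|` from the origin). [folklore] -/
theorem norm_three_point_standard
    (hcone : ∀ (ψ : h.Hilbert) (μ : Measure (EuclideanSpace ℝ (Fin 4))),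
      h.IsJointSpectralMeasure ψ μ → μ {p | p 0 < |p 1|} = 0)
    (hE3 : ∀ (π : Equiv.Perm (Fin 3)) (F : 𝓢((Fin 3 → EuclideanSpace ℝ (Fin 4)), ℂ)), IsOffDiagonal F →
      S 3 (permTest π F) = S 3 F)
    {M : ℕ} (M₂ : ℕ) (C₂ : ℝ) (hS2 : ∀ F, ‖S 2 F‖ ≤ C₂ * schwartzNorm M₂ F) (hM₂ : M₂ ≤ M)
    (M₄ : ℕ) (C₄ : ℝ) (hS4 : ∀ F, ‖S 4 F‖ ≤ C₄ * schwartzNorm M₄ F) (hM₄ : M₄ ≤ M)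
    (N : ℕ) {δ : ℝ} (hδ : 0 < δ) (hδ1 : δ ≤ 1) (c : ℝ) (f₁ f₂ g : 𝓢(EuclideanSpace ℝ (Fin 4), ℂ))
    (hf₁ : tsupport (f₁ : EuclideanSpace ℝ (Fin 4) → ℂ) ⊆ {y | y 0 < c})
    (hf₂ : tsupport (f₂ : EuclideanSpace ℝ (Fin 4) → ℂ) ⊆ {y | y 0 < c})
    (hg : tsupport (g : EuclideanSpace ℝ (Fin 4) → ℂ) ⊆ {y | c + δ < y 0})
    (hord : ∃ c' : ℝ, (tsupport (f₁ : EuclideanSpace ℝ (Fin 4) → ℂ) ⊆ {y | y 0 < c'} ∧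
        tsupport (f₂ : EuclideanSpace ℝ (Fin 4) → ℂ) ⊆ {y | c' < y 0}) ∨
      (tsupport (f₂ : EuclideanSpace ℝ (Fin 4) → ℂ) ⊆ {y | y 0 < c'} ∧
        tsupport (f₁ : EuclideanSpace ℝ (Fin 4) → ℂ) ⊆ {y | c' < y 0}))
    {w : EuclideanSpace ℝ (Fin 4)} (hw : w = EuclideanSpace.single (0 : Fin 4) (1 : ℝ) ∨
      w = EuclideanSpace.single (1 : Fin 4) (1 : ℝ)) :
    ‖S 3 (SchwartzMap.tensorFin 3 ![f₁, f₂,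
        ((∂_{w} : 𝓢(EuclideanSpace ℝ (Fin 4), ℂ) → 𝓢(EuclideanSpace ℝ (Fin 4), ℂ))^[N]) g])‖ ≤
      ((2 * N : ℕ) / (Real.exp 1 * (δ / 2))) ^ N *
        (Real.sqrt (|C₄| * (2 ^ (M₄ + 1)) ^ 4) * Real.sqrt (2 * (|C₂| * (2 ^ (M₂ + 1)) ^ 2 * 16 ^ M₂))) *
        ((2 : ℝ) ^ (3 * M) * 2 ^ (3 * M)) *
        (schwartzNorm (M + 3 * M) f₁ * schwartzNorm (M + 3 * M) f₂ * schwartzNorm (M + 3 * M) g) := by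
  set e₀ : EuclideanSpace ℝ (Fin 4) := EuclideanSpace.single (0 : Fin 4) (1 : ℝ) with he₀
  have he₀n : ‖e₀‖ = 1 := by simp [he₀]
  set a : EuclideanSpace ℝ (Fin 4) := -(c • e₀) with ha
  have han : ‖a‖ = |c| := by rw [ha, norm_neg, norm_smul, he₀n, mul_one, Real.norm_eq_abs]
  -- translated test functions
  set f₁' := SchwartzMap.compSubConstCLM ℂ a f₁ with hf₁'
  set f₂' := SchwartzMap.compSubConstCLM ℂ a f₂ with hf₂'
  set g' := SchwartzMap.compSubConstCLM ℂ a g with hg'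
  have hshift : ∀ (φ : 𝓢(EuclideanSpace ℝ (Fin 4), ℂ)) (P : ℝ → Prop),
      tsupport (φ : EuclideanSpace ℝ (Fin 4) → ℂ) ⊆ {y | P (y 0)} →
      tsupport ((SchwartzMap.compSubConstCLM ℂ a φ : 𝓢(EuclideanSpace ℝ (Fin 4), ℂ)) :
        EuclideanSpace ℝ (Fin 4) → ℂ) ⊆ {y | P (y 0 + c)} := by
    intro φ P hφ y hy
    have h1 := hφ (sub_mem_tsupport_of_mem_tsupport_compSubConstCLM a φ hy)
    simp only [mem_setOf_eq, ha, he₀, sub_neg_eq_add] at h1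
    have h2 : (y + c • EuclideanSpace.single (0 : Fin 4) (1 : ℝ)) 0 = y 0 + c := by simp
    rwa [h2] at h1
  have hf₁'s : tsupport (f₁' : EuclideanSpace ℝ (Fin 4) → ℂ) ⊆ {y | y 0 < 0} := fun y hy => by
    have := hshift f₁ (· < c) hf₁ hy; simp only [mem_setOf_eq] at this ⊢; linarith
  have hf₂'s : tsupport (f₂' : EuclideanSpace ℝ (Fin 4) → ℂ) ⊆ {y | y 0 < 0} := fun y hy => by
    have := hshift f₂ (· < c) hf₂ hy; simp only [mem_setOf_eq] at this ⊢; linarith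
  have hg's : tsupport (g' : EuclideanSpace ℝ (Fin 4) → ℂ) ⊆ {y | δ < y 0} := fun y hy => by
    have := hshift g (fun t => c + δ < t) hg hy; simp only [mem_setOf_eq] at this ⊢; linarith
  -- the translated tensor has the same value
  set q : 𝓢(EuclideanSpace ℝ (Fin 4), ℂ) :=
    ((∂_{w} : 𝓢(EuclideanSpace ℝ (Fin 4), ℂ) → 𝓢(EuclideanSpace ℝ (Fin 4), ℂ))^[N]) g with hq
  set q' : 𝓢(EuclideanSpace ℝ (Fin 4), ℂ) :=
    ((∂_{w} : 𝓢(EuclideanSpace ℝ (Fin 4), ℂ) → 𝓢(EuclideanSpace ℝ (Fin 4), ℂ))^[N]) g' with hq'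
  have hqq : q' = SchwartzMap.compSubConstCLM ℂ a q := by
    rw [hq', hg', iterate_lineDerivOp_compSubConstCLM]
  have hqs : tsupport (q : EuclideanSpace ℝ (Fin 4) → ℂ) ⊆ {y | c + δ < y 0} :=
    (tsupport_iterate_lineDerivOp_subset w N g).trans hg
  have hdis12 : Disjoint (tsupport (f₁ : EuclideanSpace ℝ (Fin 4) → ℂ)) (tsupport (f₂ : EuclideanSpace ℝ (Fin 4) → ℂ)) := by
    rcases hord with ⟨c', ⟨h1, h2⟩ | ⟨h2, h1⟩⟩
    · exact Set.disjoint_left.2 fun y hy1 hy2 => by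
        have := h1 hy1; have := h2 hy2; simp only [mem_setOf_eq] at *; linarith
    · exact Set.disjoint_left.2 fun y hy1 hy2 => by
        have := h1 hy1; have := h2 hy2; simp only [mem_setOf_eq] at *; linarith
  have hdis1q : Disjoint (tsupport (f₁ : EuclideanSpace ℝ (Fin 4) → ℂ)) (tsupport (q : EuclideanSpace ℝ (Fin 4) → ℂ)) :=
    Set.disjoint_left.2 fun y hy1 hy2 => by
      have := hf₁ hy1; have := hqs hy2; simp only [mem_setOf_eq] at *; linarith
  have hdis2q : Disjoint (tsupport (f₂ : EuclideanSpace ℝ (Fin 4) → ℂ)) (tsupport (q : EuclideanSpace ℝ (Fin 4) → ℂ)) :=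
    Set.disjoint_left.2 fun y hy1 hy2 => by
      have := hf₂ hy1; have := hqs hy2; simp only [mem_setOf_eq] at *; linarith
  have hoff : IsOffDiagonal (SchwartzMap.tensorFin 3 ![f₁, f₂, q]) := isOffDiagonal_tensorFin_three hdis12 hdis1q hdis2q
  have hT : ∀ (v : EuclideanSpace ℝ (Fin 4)) (F : 𝓢((Fin 3 → EuclideanSpace ℝ (Fin 4)), ℂ)),
      IsOffDiagonal F → S 3 (translateMulti v F) = S 3 F := fun v F hF => by
    have := h.translationInvariant 3 (fun _ => ()) v F hF
    simpa only [SchwingerFamily.toLabelled_apply] using this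
  have hval : S 3 (SchwartzMap.tensorFin 3 ![f₁, f₂, q]) = S 3 (SchwartzMap.tensorFin 3 ![f₁', f₂', q']) := by
    rw [hqq, hf₁', hf₂', ← translateMulti_tensorFin_three, hT a _ hoff]
  -- the core bound for the translated, ordered pair
  set K : ℝ := ((2 * N : ℕ) / (Real.exp 1 * (δ / 2))) ^ N *
    (Real.sqrt (|C₄| * (2 ^ (M₄ + 1)) ^ 4) * Real.sqrt (2 * (|C₂| * (2 ^ (M₂ + 1)) ^ 2 * 16 ^ M₂))) with hK
  have hK0 : 0 ≤ K := by positivity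
  have hcore : ‖S 3 (SchwartzMap.tensorFin 3 ![f₁', f₂', q'])‖ ≤
      K * schwartzNorm M₄ f₁' * schwartzNorm M₄ f₂' * schwartzNorm M₂ g' := by
    rcases hord with ⟨c', ⟨h1, h2⟩ | ⟨h2, h1⟩⟩
    · have h1' : tsupport (f₁' : EuclideanSpace ℝ (Fin 4) → ℂ) ⊆ {y | y 0 < c' - c} := fun y hy => by
        have := hshift f₁ (· < c') h1 hy; simp only [mem_setOf_eq] at this ⊢; linarith
      have h2' : tsupport (f₂' : EuclideanSpace ℝ (Fin 4) → ℂ) ⊆ {y | c' - c < y 0} := fun y hy => by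
        have := hshift f₂ (fun t => c' < t) h2 hy; simp only [mem_setOf_eq] at this ⊢; linarith
      exact norm_three_point_core S h hcone M₂ C₂ hS2 M₄ C₄ hS4 N hδ hδ1 f₁' f₂' g' h1' h2' hf₂'s hg's hw
    · have h1' : tsupport (f₁' : EuclideanSpace ℝ (Fin 4) → ℂ) ⊆ {y | c' - c < y 0} := fun y hy => by
        have := hshift f₁ (fun t => c' < t) h1 hy; simp only [mem_setOf_eq] at this ⊢; linarith
      have h2' : tsupport (f₂' : EuclideanSpace ℝ (Fin 4) → ℂ) ⊆ {y | y 0 < c' - c} := fun y hy => by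
        have := hshift f₂ (· < c') h2 hy; simp only [mem_setOf_eq] at this ⊢; linarith
      -- swap the pair by E3
      have hq's : tsupport (q' : EuclideanSpace ℝ (Fin 4) → ℂ) ⊆ {y | δ < y 0} :=
        (tsupport_iterate_lineDerivOp_subset w N g').trans hg's
      have hd21 : Disjoint (tsupport (f₂' : EuclideanSpace ℝ (Fin 4) → ℂ)) (tsupport (f₁' : EuclideanSpace ℝ (Fin 4) → ℂ)) :=
        Set.disjoint_left.2 fun y hy1 hy2 => by
          have := h2' hy1; have := h1' hy2; simp only [mem_setOf_eq] at *; linarith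
      have hd2q : Disjoint (tsupport (f₂' : EuclideanSpace ℝ (Fin 4) → ℂ)) (tsupport (q' : EuclideanSpace ℝ (Fin 4) → ℂ)) :=
        Set.disjoint_left.2 fun y hy1 hy2 => by
          have := hf₂'s hy1; have := hq's hy2; simp only [mem_setOf_eq] at *; linarith
      have hd1q : Disjoint (tsupport (f₁' : EuclideanSpace ℝ (Fin 4) → ℂ)) (tsupport (q' : EuclideanSpace ℝ (Fin 4) → ℂ)) :=
        Set.disjoint_left.2 fun y hy1 hy2 => by
          have := hf₁'s hy1; have := hq's hy2; simp only [mem_setOf_eq] at *; linarith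
      have hoff' : IsOffDiagonal (SchwartzMap.tensorFin 3 ![f₂', f₁', q']) :=
        isOffDiagonal_tensorFin_three hd21 hd2q hd1q
      rw [← permTest_swap_tensorFin_three f₁' f₂' q', hE3 _ _ hoff']
      have := norm_three_point_core S h hcone M₂ C₂ hS2 M₄ C₄ hS4 N hδ hδ1 f₂' f₁' g' h2' h1' hf₁'s hg's hw
      calc _ ≤ K * schwartzNorm M₄ f₂' * schwartzNorm M₄ f₁' * schwartzNorm M₂ g' := this
        _ = K * schwartzNorm M₄ f₁' * schwartzNorm M₄ f₂' * schwartzNorm M₂ g' := by ring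
  -- translated Schwartz norms
  have htr : ∀ (φ : 𝓢(EuclideanSpace ℝ (Fin 4), ℂ)) {M' : ℕ}, M' ≤ M →
      schwartzNorm M' (SchwartzMap.compSubConstCLM ℂ a φ) ≤ 2 ^ M * (1 + |c|) ^ M * schwartzNorm M φ := by
    intro φ M' hM'
    refine (NuclearExpansion.schwartzNorm_compSubConstCLM_le M' a φ).trans ?_
    rw [han, ← mul_pow]
    have h1 : (1 : ℝ) ≤ 2 * (1 + |c|) := by linarith [abs_nonneg c]
    exact mul_le_mul (pow_le_pow_right₀ h1 hM') (schwartzNorm_mono hM' φ) (schwartzNorm_nonneg _ _)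
      (by positivity)
  have hn1 := htr f₁ hM₄
  have hn2 := htr f₂ hM₄
  have hn3 := htr g hM₂
  have h0f₁ := schwartzNorm_nonneg M f₁
  have h0f₂ := schwartzNorm_nonneg M f₂
  have h0g := schwartzNorm_nonneg M g
  have hU0 : 0 ≤ (2 : ℝ) ^ M * (1 + |c|) ^ M := by positivity
  have h2p : (2 : ℝ) ^ M * 2 ^ M * 2 ^ M = 2 ^ (3 * M) := by
    rw [← pow_add, ← pow_add]; congr 1; ring
  have hup : (1 + |c|) ^ M * (1 + |c|) ^ M * (1 + |c|) ^ M = (1 + |c|) ^ (3 * M) := by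
    rw [← pow_add, ← pow_add]; congr 1; ring
  have hstep : ‖S 3 (SchwartzMap.tensorFin 3 ![f₁, f₂, q])‖ ≤
      K * (2 : ℝ) ^ (3 * M) * ((1 + |c|) ^ (3 * M) * (schwartzNorm M f₁ * schwartzNorm M f₂ * schwartzNorm M g)) := by
    rw [hval]
    refine hcore.trans ?_
    have h02 := schwartzNorm_nonneg M₄ f₂'
    have h03 := schwartzNorm_nonneg M₂ g'
    have hs1 : K * schwartzNorm M₄ f₁' ≤ K * (2 ^ M * (1 + |c|) ^ M * schwartzNorm M f₁) :=
      mul_le_mul_of_nonneg_left hn1 hK0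
    have hs2 : K * schwartzNorm M₄ f₁' * schwartzNorm M₄ f₂' ≤
        K * (2 ^ M * (1 + |c|) ^ M * schwartzNorm M f₁) * (2 ^ M * (1 + |c|) ^ M * schwartzNorm M f₂) :=
      mul_le_mul hs1 hn2 h02 (mul_nonneg hK0 (mul_nonneg hU0 h0f₁))
    have hs3 : K * schwartzNorm M₄ f₁' * schwartzNorm M₄ f₂' * schwartzNorm M₂ g' ≤
        K * (2 ^ M * (1 + |c|) ^ M * schwartzNorm M f₁) * (2 ^ M * (1 + |c|) ^ M * schwartzNorm M f₂) *
          (2 ^ M * (1 + |c|) ^ M * schwartzNorm M g) :=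
      mul_le_mul hs2 hn3 h03 (mul_nonneg (mul_nonneg hK0 (mul_nonneg hU0 h0f₁)) (mul_nonneg hU0 h0f₂))
    refine hs3.trans (le_of_eq ?_)
    rw [← h2p, ← hup]
    ring
  -- absorption of `(1 + |c|)^{3M}`
  have habs : (1 + |c|) ^ (3 * M) * (schwartzNorm M f₁ * schwartzNorm M f₂ * schwartzNorm M g) ≤
      2 ^ (3 * M) * (schwartzNorm (M + 3 * M) f₁ * schwartzNorm (M + 3 * M) f₂ * schwartzNorm (M + 3 * M) g) := by
    have hm1 := schwartzNorm_mono (Nat.le_add_right M (3 * M)) f₁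
    have hm2 := schwartzNorm_mono (Nat.le_add_right M (3 * M)) f₂
    have hm3 := schwartzNorm_mono (Nat.le_add_right M (3 * M)) g
    rcases le_or_gt 0 c with hc | hc
    · -- `g` lives at distance `≥ c` from the origin
      have hgfar : tsupport (g : EuclideanSpace ℝ (Fin 4) → ℂ) ⊆ {y | |c| ≤ ‖y‖} := fun y hy => by
        have h1 := hg hy
        simp only [mem_setOf_eq] at h1 ⊢
        have h2 : |y 0| ≤ ‖y‖ := by
          rw [← Real.norm_eq_abs]; exact PiLp.norm_apply_le y 0
        rw [abs_of_nonneg hc]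
        have h3 : y 0 ≤ |y 0| := le_abs_self _
        linarith
      have hA := one_add_pow_mul_schwartzNorm_le g (abs_nonneg c) hgfar M (3 * M)
      have hB : schwartzNorm M f₁ * schwartzNorm M f₂ ≤ schwartzNorm (M + 3 * M) f₁ * schwartzNorm (M + 3 * M) f₂ :=
        mul_le_mul hm1 hm2 h0f₂ (h0f₁.trans hm1)
      calc (1 + |c|) ^ (3 * M) * (schwartzNorm M f₁ * schwartzNorm M f₂ * schwartzNorm M g)
          = schwartzNorm M f₁ * schwartzNorm M f₂ * ((1 + |c|) ^ (3 * M) * schwartzNorm M g) := by ring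
        _ ≤ schwartzNorm (M + 3 * M) f₁ * schwartzNorm (M + 3 * M) f₂ * (2 ^ (3 * M) * schwartzNorm (M + 3 * M) g) :=
            mul_le_mul hB hA (by positivity) (mul_nonneg (h0f₁.trans hm1) (h0f₂.trans hm2))
        _ = _ := by ring
    · -- `f₁` lives at distance `≥ |c|` from the origin
      have hffar : tsupport (f₁ : EuclideanSpace ℝ (Fin 4) → ℂ) ⊆ {y | |c| ≤ ‖y‖} := fun y hy => by
        have h1 := hf₁ hy
        simp only [mem_setOf_eq] at h1 ⊢
        have h2 : |y 0| ≤ ‖y‖ := by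
          rw [← Real.norm_eq_abs]; exact PiLp.norm_apply_le y 0
        rw [abs_of_neg hc]
        have h3 : -(y 0) ≤ |y 0| := neg_le_abs _
        linarith
      have hA := one_add_pow_mul_schwartzNorm_le f₁ (abs_nonneg c) hffar M (3 * M)
      have hA0 : 0 ≤ 2 ^ (3 * M) * schwartzNorm (M + 3 * M) f₁ := by
        have := schwartzNorm_nonneg (M + 3 * M) f₁; positivity
      calc (1 + |c|) ^ (3 * M) * (schwartzNorm M f₁ * schwartzNorm M f₂ * schwartzNorm M g)
          = ((1 + |c|) ^ (3 * M) * schwartzNorm M f₁) * schwartzNorm M f₂ * schwartzNorm M g := by ring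
        _ ≤ (2 ^ (3 * M) * schwartzNorm (M + 3 * M) f₁) * schwartzNorm (M + 3 * M) f₂ * schwartzNorm (M + 3 * M) g :=
            mul_le_mul (mul_le_mul hA hm2 h0f₂ hA0) hm3 h0g (mul_nonneg hA0 (h0f₂.trans hm2))
        _ = _ := by ring
  calc ‖S 3 (SchwartzMap.tensorFin 3 ![f₁, f₂, q])‖
      ≤ K * (2 : ℝ) ^ (3 * M) * ((1 + |c|) ^ (3 * M) * (schwartzNorm M f₁ * schwartzNorm M f₂ * schwartzNorm M g)) := hstep
    _ ≤ K * (2 : ℝ) ^ (3 * M) * (2 ^ (3 * M) * (schwartzNorm (M + 3 * M) f₁ * schwartzNorm (M + 3 * M) f₂ *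
          schwartzNorm (M + 3 * M) g)) := mul_le_mul_of_nonneg_left habs (by positivity)
    _ = _ := by ring

end Standard

end Summit.QuantumFields.YangMills.Theorems.TemperedCurvatureMoments.Sketch.ThreePointChartBounds

end
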